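import Literature.NumberTheory.EllipticCurves.ProfiniteGroupDistributionTwisting
import HarnessLib

/-!
# Bounded distributions on a group along a subgroup tower, XIV: the GENERATION hypotheses of the
# division step from the cyclicity of the levels `U_s/U_n` (de Shalit 1987, II.4.12:
# `Gal(K(𝔣𝔭ⁿ)/K(𝔣𝔭^s)) ≃ (1 + 𝔭^s ℤ_p)/(1 + 𝔭ⁿ ℤ_p)` is cyclic)

The division theorems (`exists_twisting_μ_eq`, `…_of_cocycle_natCast`, `exists_twisting_μ_eq_forall_of_units`)
take as hypotheses that `σ ∈ U_s` GENERATES `U_s` modulo every `U_n`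
(`hgen : ∀ n ≥ s, ∀ u ∈ U_s, ∃ k, proj n (σ^k) = proj n u`) and that the order of `σ̄ = σU_n` is a power
of `p`, unboundedly in `n` (`hpow`, `hunb`). The assembler obtains from class field theory the
STRUCTURE of the levels: the image of `U_s` in `G/U_n` is the cyclic group generated by `σ̄` (the Artin
symbol of a principal `(α)`, `α ≡ 1 mod 𝔣𝔭^s`, `α ≢ 1 mod 𝔭^{s+1}`), of order `[U_s : U_n] = p^{n−s}`.
This file converts the latter into the former:

* `exists_pow_proj_eq_of_map_le_zpowers` — `hgen` at level `n` from
  `(U_s).map (mk' U_n) ≤ zpowers σ̄`;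
* `orderOf_proj_eq_relIndex` — `ord σ̄ = [U_s : U_n]` from `(U_s).map (mk' U_n) = zpowers σ̄`;
* `orderOf_proj_eq_pow_of_relIndex` (`hpow`) and `exists_pow_dvd_orderOf_proj_of_relIndex` (`hunb`)
  when `[U_s : U_n] = p^{n−s}`.

Everything is a theorem; no named facts, no instances, no `sorry`.

## References

* [deShalit1987] E. de Shalit, *Iwasawa theory of elliptic curves with complex multiplication* (1987),
  II.4.12 (p. 68), II.1.7 (p. 39: the structure of `Gal(K(𝔣𝔭ⁿ)/K(𝔣))`).
-/

noncomputable section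

open scoped Classical

namespace Literature.NumberTheory.EllipticCurves

namespace SubgroupTower

variable {G : Type*} [Group G] (𝒰 : SubgroupTower G) [∀ n, (𝒰.U n).Normal]

/-- **`hgen` from cyclicity**: if the image of `U_s` in `G/U_n` lies in the cyclic group generated by
`σ̄ = σU_n`, then every `u ∈ U_s` is `≡ σ^k mod U_n` for some `k : ℕ`.
[cite: deShalit1987, II.4.12 (p. 68)] -/
theorem exists_pow_proj_eq_of_map_le_zpowers {s n : ℕ} {σ : G}
    (h : (𝒰.U s).map (QuotientGroup.mk' (𝒰.U n)) ≤ Subgroup.zpowers (𝒰.proj n σ)) {u : G}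
    (hu : u ∈ 𝒰.U s) : ∃ k : ℕ, 𝒰.proj n (σ ^ k) = 𝒰.proj n u := by
  haveI := 𝒰.finiteIndex n
  have hmem : 𝒰.proj n u ∈ Subgroup.zpowers (𝒰.proj n σ) := h ⟨u, hu, rfl⟩
  rw [← mem_powers_iff_mem_zpowers, Submonoid.mem_powers_iff] at hmem
  obtain ⟨k, hk⟩ := hmem
  exact ⟨k, by rw [𝒰.proj_pow]; exact hk⟩

/-- **`hgen` at all levels** from cyclicity at all levels `n ≥ s`.
[cite: deShalit1987, II.4.12 (p. 68)] -/
theorem hgen_of_map_le_zpowers {s : ℕ} {σ : G}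
    (h : ∀ n, s ≤ n → (𝒰.U s).map (QuotientGroup.mk' (𝒰.U n)) ≤ Subgroup.zpowers (𝒰.proj n σ)) :
    ∀ n, s ≤ n → ∀ u ∈ 𝒰.U s, ∃ k : ℕ, 𝒰.proj n (σ ^ k) = 𝒰.proj n u :=
  fun n hn _ hu => 𝒰.exists_pow_proj_eq_of_map_le_zpowers (h n hn) hu

/-- **`ord σ̄ = [U_s : U_n]`** when the image of `U_s` in `G/U_n` IS the cyclic group generated by `σ̄`
(`s ≤ n`). [cite: deShalit1987, II.4.12 (p. 68)] -/
theorem orderOf_proj_eq_relIndex {s n : ℕ} (hsn : s ≤ n) {σ : G}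
    (h : (𝒰.U s).map (QuotientGroup.mk' (𝒰.U n)) = Subgroup.zpowers (𝒰.proj n σ)) :
    orderOf (𝒰.proj n σ) = (𝒰.U n).relIndex (𝒰.U s) := by
  haveI := 𝒰.finiteIndex n
  haveI := 𝒰.finiteIndex s
  have h1 : Nat.card ((𝒰.U s).map (QuotientGroup.mk' (𝒰.U n))) * (𝒰.U s).index = (𝒰.U n).index := by
    rw [← Subgroup.index_map_eq (𝒰.U s) (QuotientGroup.mk'_surjective (𝒰.U n))
      (by rw [QuotientGroup.ker_mk']; exact 𝒰.le_of_le hsn), Subgroup.card_mul_index]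
    rfl
  rw [h, Nat.card_zpowers] at h1
  have h2 := Subgroup.relIndex_mul_index (𝒰.le_of_le hsn)
  have hne : (𝒰.U s).index ≠ 0 := Subgroup.FiniteIndex.index_ne_zero
  exact Nat.eq_of_mul_eq_mul_right (Nat.pos_of_ne_zero hne) (h1.trans h2.symm)

/-- **`hpow`**: if moreover `[U_s : U_n] = p^{n−s}` then `ord σ̄` is a power of `p`.
[cite: deShalit1987, II.4.12 (p. 68)] -/
theorem orderOf_proj_eq_pow_of_relIndex {p s : ℕ} {σ : G}
    (h : ∀ n, s ≤ n → (𝒰.U s).map (QuotientGroup.mk' (𝒰.U n)) = Subgroup.zpowers (𝒰.proj n σ))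
    (hind : ∀ n, s ≤ n → (𝒰.U n).relIndex (𝒰.U s) = p ^ (n - s)) (n : ℕ) (hn : s ≤ n) :
    ∃ e : ℕ, orderOf (𝒰.proj n σ) = p ^ e :=
  ⟨n - s, by rw [𝒰.orderOf_proj_eq_relIndex hn (h n hn), hind n hn]⟩

/-- **`hunb`**: if `[U_s : U_n] = p^{n−s}` for all `n ≥ s` then the orders of `σ̄` are divisible by
arbitrarily large powers of `p`. [cite: deShalit1987, II.4.12 (p. 68)] -/
theorem exists_pow_dvd_orderOf_proj_of_relIndex {p s : ℕ} {σ : G}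
    (h : ∀ n, s ≤ n → (𝒰.U s).map (QuotientGroup.mk' (𝒰.U n)) = Subgroup.zpowers (𝒰.proj n σ))
    (hind : ∀ n, s ≤ n → (𝒰.U n).relIndex (𝒰.U s) = p ^ (n - s)) (e : ℕ) :
    ∃ m, p ^ e ∣ orderOf (𝒰.proj m σ) :=
  ⟨s + e, by
    rw [𝒰.orderOf_proj_eq_relIndex (Nat.le_add_right s e) (h _ (Nat.le_add_right s e)),
      hind _ (Nat.le_add_right s e), Nat.add_sub_cancel_left]⟩

/-- Membership in `U_s` of an element whose class generates the image: if
`(U_s).map (mk' U_n) = zpowers σ̄` then some element of `U_s` has class `σ̄`; in applications `σ`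
itself is taken in `U_s`. This records the converse bookkeeping: for `σ ∈ U_s`,
`zpowers σ̄ ≤ (U_s).map (mk' U_n)`. [cite: deShalit1987, II.4.12 (p. 68)] -/
theorem zpowers_le_map_of_mem {s n : ℕ} {σ : G} (hσ : σ ∈ 𝒰.U s) :
    Subgroup.zpowers (𝒰.proj n σ) ≤ (𝒰.U s).map (QuotientGroup.mk' (𝒰.U n)) := by
  rw [Subgroup.zpowers_le]
  exact ⟨σ, hσ, rfl⟩

end SubgroupTower

end Literature.NumberTheory.EllipticCurves

end
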